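import Summits.ABC.ABC.Theses.IneffectiveSubspace
import Summits.ABC.ABC.Theorems.IneffectiveSubspaceUniformSadicTowerFourNormalForm
import Summits.ABC.ABC.Theorems.IneffectiveSubspaceUniformSadicTowerFourStubUniformInKIffAbc
import Summits.ABC.ABC.Theorems.IneffectiveSubspaceUniformSadicTowerFourQuarticRootWall

/-!
# `UniformSadicTowerFour` (stmt-ABC-14937): the FLAT / STEEP split of the crux (glue of line `flat-steep-split`)

Crux (route `IneffectiveSubspace`, rank 2), in its landed normal form (`MixedRadical.stub_normalForm`): for every
`K`, `ε > 0` there is `C` with `c < C · M_S(abc)^(1+ε)` for every abc triple `(a, b, c)` and every set `S` of at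
most `K` primes, `M_S(N) = (∏_{p ∈ S} p) · ∏_{p ∣ N, p ∉ S} p^⌈v_p(N)/4⌉` the mixed radical (`⌈v/4⌉ = (v+3)/4`).

Call a prime `p ∣ abc` θ-HEAVY for the triple if `c^θ ≤ p^{v_p(abc)}`.  This file proves, sorry-free, that the crux is
EQUIVALENT to the conjunction of two hypothesis-free statements, each a proper regime of it:

* FLAT FACE — the `K = 0` face (abc with the 4-rounded radical `rad₄(N) = ∏ p^⌈v_p(N)/4⌉`) for triples all of whose
  prime-power blocks are `< c^θ`, for every `θ ∈ (0, 1/4]`;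
* HEAVY PLACES — the crux for NON-EMPTY `S` all of whose primes are θ-heavy, for every `θ > 0`.

`uniformSadicTowerFour_of_flat_of_heavy` (flat → heavy → crux): given `K, ε₀` put `ε₁ = ε₀/2`,
`θ = min(ε₀/((K+1)(1+ε₀)(2+ε₀)), 1/4)`; for `S` and a triple let `T ⊆ S` be its θ-heavy part; if `T ≠ ∅` use HEAVY
PLACES at `T`, if `T = ∅` but some prime of `abc` is heavy use HEAVY PLACES at budget `1` on it, else the triple is flat
and the FLAT FACE applies; in each case the ≤ `K` light primes of `S ∖ T` are moved back into the bracket at cost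
`< c^{θK}` (`mixed_le_mixed_mul`, `rounded_le_full`, `light_prod_le`) and `c < C (M_S c^{θK})^(1+ε₁)` rearranges to
`c < C² M_S^(1+ε₀)` (`real_step`).  `flatFace_of_uniformSadicTowerFour`, `heavyPlaces_of_uniformSadicTowerFour`: the
converses (instances `K = 0, S = ∅` resp. budget `K` of the normal form).

Sources: strategist line `flat-steep-split` (Cruxes/UniformSadicTowerFour/Lines/flat_steep_split.lean, STRATEGY-CENSUS.md);
BarrierNotes-r1-k2 B1 (the planner was asked to split #2 into its K = 0 face and the K ≥ 1 uniformity).  No new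
definitions; `IsABCTriple`, `primeFactors`, `factorization` only.  Deliberately NOT here: the two regimes themselves
(open; they are the registered stubs `stub_flatFace`, `stub_heavyPlaces` of the line).
-/

noncomputable section

-- `Summit.<Summit>.<Problem>` is the mandated summit-side namespace (CONVENTIONS §2); for the
-- single-conjunct summit `ABC` the two coincide, so the duplicate `ABC.ABC` is deliberate.
set_option linter.dupNamespace false

namespace Summit.ABC.ABC.Theorems.UniformSadicTowerFour.FlatSteepSplit

open Literature.NumberTheory.DiophantineGeometry (IsABCTriple rad rad_def)
open Summit.ABC.ABC.Theses.IneffectiveSubspace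
open Summit.ABC.ABC.Theorems.UniformSadicTowerFour.MixedRadical
open Summit.ABC.ABC.Theorems.UniformSadicTowerFour.QuarticRootWall
  (lt_rpow_mul_rpow_of_rpow_lt rpow_mul_rpow_le)
open scoped BigOperators

/-! ## Bookkeeping: moving light primes of `S` back into the bracket -/

/-- Splitting the rounded bracket off `T ⊆ S` into the part off `S` and the part in `S ∖ T`. [folklore] -/
theorem rounded_sdiff_split (N : ℕ) {S T : Finset ℕ} (hTS : T ⊆ S) :
    ∏ p ∈ N.primeFactors \ T, p ^ ((N.factorization p + 3) / 4) =
      (∏ p ∈ N.primeFactors \ S, p ^ ((N.factorization p + 3) / 4)) *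
        ∏ p ∈ (N.primeFactors \ T) ∩ S, p ^ ((N.factorization p + 3) / 4) := by
  have hsub : (N.primeFactors \ T) ∩ S ⊆ N.primeFactors \ T := Finset.inter_subset_left
  have hsd : (N.primeFactors \ T) \ ((N.primeFactors \ T) ∩ S) = N.primeFactors \ S := by
    ext q
    simp only [Finset.mem_sdiff, Finset.mem_inter]
    constructor
    · rintro ⟨⟨hq, hqT⟩, h2⟩
      exact ⟨hq, fun hqS => h2 ⟨⟨hq, hqT⟩, hqS⟩⟩
    · rintro ⟨hq, hqS⟩
      exact ⟨⟨hq, fun hqT => hqS (hTS hqT)⟩, fun h => hqS h.2⟩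
  rw [← Finset.prod_sdiff hsub, hsd]

/-- **Exchange inequality.** For `T ⊆ S` (primes), `M_T(N) ≤ M_S(N) · ∏_{p ∈ (supp N ∖ T) ∩ S} p^⌈v_p/4⌉`:
moving the primes of `S ∖ T` from the rounded bracket to the linear `S`-factor costs at most their
rounded charges. [folklore] -/
theorem mixed_le_mixed_mul (N : ℕ) {S T : Finset ℕ} (hTS : T ⊆ S) (hS : ∀ p ∈ S, Nat.Prime p) :
    (∏ p ∈ T, p) * ∏ p ∈ N.primeFactors \ T, p ^ ((N.factorization p + 3) / 4) ≤
      ((∏ p ∈ S, p) * ∏ p ∈ N.primeFactors \ S, p ^ ((N.factorization p + 3) / 4)) *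
        ∏ p ∈ (N.primeFactors \ T) ∩ S, p ^ ((N.factorization p + 3) / 4) := by
  have hTle : ∏ p ∈ T, p ≤ ∏ p ∈ S, p :=
    Finset.prod_le_prod_of_subset_of_one_le' hTS fun p hp _ => (hS p hp).one_lt.le
  rw [rounded_sdiff_split N hTS, ← mul_assoc]
  exact Nat.mul_le_mul_right _ (Nat.mul_le_mul_right _ hTle)

/-- Rounding only lowers a charge: on a set of prime factors of `N`, `∏ p^⌈v_p/4⌉ ≤ ∏ p^{v_p}`. [folklore] -/
theorem rounded_le_full (N : ℕ) {A : Finset ℕ} (hA : A ⊆ N.primeFactors) :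
    ∏ p ∈ A, p ^ ((N.factorization p + 3) / 4) ≤ ∏ p ∈ A, p ^ N.factorization p := by
  refine Finset.prod_le_prod' fun p hp => ?_
  have hpN := Nat.mem_primeFactors.mp (hA hp)
  have hv : 0 < N.factorization p := hpN.1.factorization_pos_of_dvd hpN.2.2 hpN.2.1
  exact Nat.pow_le_pow_right hpN.1.pos (by omega)

/-- At most `K` light blocks cost less than `(c^θ)^K`. [folklore] -/
theorem light_prod_le {N c K : ℕ} {θ : ℝ} {A : Finset ℕ} (hc : 1 ≤ c) (hθ : 0 ≤ θ)
    (hcard : A.card ≤ K)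
    (hlight : ∀ q ∈ A, ((q ^ N.factorization q : ℕ) : ℝ) < (c : ℝ) ^ θ) :
    ((∏ q ∈ A, q ^ N.factorization q : ℕ) : ℝ) ≤ ((c : ℝ) ^ θ) ^ K := by
  have hc1 : (1 : ℝ) ≤ c := by exact_mod_cast hc
  have h1 : (1 : ℝ) ≤ (c : ℝ) ^ θ := Real.one_le_rpow hc1 hθ
  calc ((∏ q ∈ A, q ^ N.factorization q : ℕ) : ℝ)
      = ∏ q ∈ A, ((q ^ N.factorization q : ℕ) : ℝ) := by push_cast; rfl
    _ ≤ ∏ _q ∈ A, (c : ℝ) ^ θ :=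
        Finset.prod_le_prod (fun q _ => by positivity) fun q hq => (hlight q hq).le
    _ = ((c : ℝ) ^ θ) ^ A.card := Finset.prod_const _
    _ ≤ ((c : ℝ) ^ θ) ^ K := pow_le_pow_right₀ h1 hcard

/-! ## The real rearrangement -/

/-- If `c < C · X^s`, `X ≤ M · c^d` with `C, M, c ≥ 1`, `X ≥ 0`, `s > 0`, `d ≥ 0`, `d·s ≤ 1/2` and
`s ≤ t·(1 − d·s)`, then `c < C² · M^t`. [folklore] -/
theorem real_step {C s d t c M X : ℝ} (hC : 1 ≤ C) (hs : 0 < s)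
    (hds : d * s ≤ 1 / 2) (hst : s ≤ t * (1 - d * s)) (hc : 1 ≤ c) (hM : 1 ≤ M) (hX0 : 0 ≤ X)
    (hX : X ≤ M * c ^ d) (h : c < C * X ^ s) : c < C ^ (2 : ℝ) * M ^ t := by
  have hc0 : 0 < c := by linarith
  have hM0 : 0 ≤ M := by linarith
  have hC0 : 0 ≤ C := by linarith
  -- c < C * M^s * c^(d*s)
  have h1 : c < C * M ^ s * c ^ (d * s) := by
    have hXs : X ^ s ≤ (M * c ^ d) ^ s := Real.rpow_le_rpow hX0 hX hs.le
    have : (M * c ^ d) ^ s = M ^ s * c ^ (d * s) := by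
      rw [Real.mul_rpow hM0 (Real.rpow_nonneg hc0.le d), ← Real.rpow_mul hc0.le]
    calc c < C * X ^ s := h
      _ ≤ C * (M * c ^ d) ^ s := mul_le_mul_of_nonneg_left hXs hC0
      _ = C * M ^ s * c ^ (d * s) := by rw [this, mul_assoc]
  -- c^(1 - d s) < C * M^s
  have hγ : 0 < 1 - d * s := by linarith
  have h2 : c ^ (1 - d * s) < C * M ^ s := by
    rw [Real.rpow_sub hc0, Real.rpow_one, div_lt_iff₀ (Real.rpow_pos_of_pos hc0 _)]
    exact h1
  -- c < C^(1/(1-ds)) * M^(s/(1-ds)) ≤ C^2 * M^t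
  have h3 := lt_rpow_mul_rpow_of_rpow_lt hc0.le hC0 hM0 hγ h2
  refine h3.trans_le (rpow_mul_rpow_le hC hM ?_ ?_)
  · rw [div_le_iff₀ hγ]; linarith
  · rw [div_le_iff₀ hγ]; linarith

/-! ## Composition -/

/-- **The split, sorry-free**: flat face + heavy places ⟹ `UniformSadicTowerFour` (through the
landed normal form `stub_normalForm`): the glue theorem of the flat/steep decomposition. [folklore] -/
theorem uniformSadicTowerFour_of_flat_of_heavy
    (h₁ : ∀ θ : ℝ, 0 < θ → θ ≤ 1 / 4 → ∀ ε : ℝ, 0 < ε → ∃ C : ℝ, 0 < C ∧ ∀ a b c : ℕ,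
      IsABCTriple a b c →
      (∀ p ∈ (a * b * c).primeFactors,
        ((p ^ (a * b * c).factorization p : ℕ) : ℝ) < (c : ℝ) ^ θ) →
      (c : ℝ) < C * ((∏ p ∈ (a * b * c).primeFactors,
        p ^ (((a * b * c).factorization p + 3) / 4) : ℕ) : ℝ) ^ (1 + ε))
    (h₂ : ∀ K : ℕ, ∀ θ : ℝ, 0 < θ → ∀ ε : ℝ, 0 < ε → ∃ C : ℝ, 0 < C ∧ ∀ S : Finset ℕ, S.Nonempty →
      S.card ≤ K → (∀ p ∈ S, Nat.Prime p) → ∀ a b c : ℕ, IsABCTriple a b c →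
      (∀ p ∈ S, (c : ℝ) ^ θ ≤ ((p ^ (a * b * c).factorization p : ℕ) : ℝ)) →
      (c : ℝ) < C * ((((∏ p ∈ S, p) *
        ∏ p ∈ (a * b * c).primeFactors \ S, p ^ (((a * b * c).factorization p + 3) / 4) : ℕ) : ℝ)) ^
          (1 + ε)) :
    UniformSadicTowerFour := by
  classical
  refine stub_normalForm.mpr ?_
  intro K ε₀ hε₀
  -- parameters
  set ε₁ : ℝ := ε₀ / 2 with hε₁def
  have hε₁ : 0 < ε₁ := by positivity
  set D : ℝ := ((K : ℝ) + 1) * ((1 + ε₀) * (2 + ε₀)) with hDdef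
  have hD : 0 < D := by positivity
  set θ₀ : ℝ := ε₀ / D with hθ₀def
  have hθ₀ : 0 < θ₀ := by positivity
  have hθ₀D : θ₀ * D = ε₀ := div_mul_cancel₀ ε₀ hD.ne'
  set θ : ℝ := min θ₀ (1 / 4) with hθdef
  have hθ : 0 < θ := lt_min hθ₀ (by norm_num)
  have hθle : θ ≤ θ₀ := min_le_left _ _
  have hθ4 : θ ≤ 1 / 4 := min_le_right _ _
  -- the key size of θ: θ·K·(1+ε₀)(2+ε₀) ≤ ε₀
  have hθK : θ * K * ((1 + ε₀) * (2 + ε₀)) ≤ ε₀ := by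
    have hK1 : (K : ℝ) ≤ K + 1 := by linarith
    calc θ * K * ((1 + ε₀) * (2 + ε₀)) ≤ θ₀ * (K + 1) * ((1 + ε₀) * (2 + ε₀)) := by
          gcongr
      _ = θ₀ * D := by rw [hDdef]; ring
      _ = ε₀ := hθ₀D
  -- constants
  obtain ⟨C₁, hC₁, hflat⟩ := h₁ θ hθ hθ4 ε₁ hε₁
  obtain ⟨C₂, hC₂, hheavyK⟩ := h₂ K θ hθ ε₁ hε₁
  obtain ⟨C₃, hC₃, hheavy1⟩ := h₂ 1 θ hθ ε₁ hε₁
  set C₀ : ℝ := max (max C₁ C₂) (max C₃ 1) with hC₀def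
  have hC₀1 : 1 ≤ C₀ := le_max_of_le_right (le_max_right _ _)
  have hC₁le : C₁ ≤ C₀ := le_max_of_le_left (le_max_left _ _)
  have hC₂le : C₂ ≤ C₀ := le_max_of_le_left (le_max_right _ _)
  have hC₃le : C₃ ≤ C₀ := le_max_of_le_right (le_max_left _ _)
  refine ⟨C₀ ^ (2 : ℝ), by positivity, fun S hcard hS a b c habc => ?_⟩
  obtain ⟨ha, hb, hsum, hcop⟩ := habc
  set N := a * b * c with hNdef
  have hc1 : 1 ≤ c := by omega
  have hc1R : (1 : ℝ) ≤ c := by exact_mod_cast hc1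
  have hN0 : N ≠ 0 := by positivity
  -- exponent data for `real_step`
  have hs : (0 : ℝ) < 1 + ε₁ := by linarith
  have hd : (0 : ℝ) ≤ θ * K := by positivity
  have hds : θ * K * (1 + ε₁) ≤ 1 / 2 := by
    rw [hε₁def]; nlinarith [hθK, hε₀, hd, mul_nonneg hd hε₀.le]
  have hst : 1 + ε₁ ≤ (1 + ε₀) * (1 - θ * K * (1 + ε₁)) := by
    rw [hε₁def]; nlinarith [hθK, hε₀, hd]
  -- the mixed radical at `S` is ≥ 1
  have hMSpos := uniformInK_mixed_pos N S hS
  have hMS1 : (1 : ℝ) ≤ (((∏ p ∈ S, p) *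
      ∏ p ∈ N.primeFactors \ S, p ^ ((N.factorization p + 3) / 4) : ℕ) : ℝ) := by
    exact_mod_cast hMSpos
  -- (c^θ)^K = c^(θK)
  have hcθK : ((c : ℝ) ^ θ) ^ K = (c : ℝ) ^ (θ * K) := by
    rw [← Real.rpow_natCast, ← Real.rpow_mul (by positivity : (0 : ℝ) ≤ c)]
  -- the heavy part of S
  set T := S.filter (fun q => (c : ℝ) ^ θ ≤ ((q ^ N.factorization q : ℕ) : ℝ)) with hTdef
  have hTS : T ⊆ S := Finset.filter_subset _ _
  -- light primes of `S ∖ T'` for the two choices `T' = T` and `T' = ∅`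
  have hlightT : ∀ q ∈ (N.primeFactors \ T) ∩ S,
      ((q ^ N.factorization q : ℕ) : ℝ) < (c : ℝ) ^ θ := by
    intro q hq
    rw [Finset.mem_inter, Finset.mem_sdiff] at hq
    by_contra hle
    exact hq.1.2 (Finset.mem_filter.mpr ⟨hq.2, not_lt.mp hle⟩)
  -- GENERIC STEP: a bound `c < C' X^(1+ε₁)` with `X ≤ M_S · ∏_{light} q^{v_q}` closes the goal
  have finish : ∀ (C' : ℝ) (X : ℕ) (A : Finset ℕ), C' ≤ C₀ → A ⊆ S → A ⊆ N.primeFactors →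
      (∀ q ∈ A, ((q ^ N.factorization q : ℕ) : ℝ) < (c : ℝ) ^ θ) →
      X ≤ ((∏ p ∈ S, p) * ∏ p ∈ N.primeFactors \ S, p ^ ((N.factorization p + 3) / 4)) *
        ∏ q ∈ A, q ^ N.factorization q →
      (c : ℝ) < C' * (X : ℝ) ^ (1 + ε₁) →
      (c : ℝ) < C₀ ^ (2 : ℝ) * ((((∏ p ∈ S, p) *
        ∏ p ∈ N.primeFactors \ S, p ^ ((N.factorization p + 3) / 4) : ℕ) : ℝ)) ^ (1 + ε₀) := by
    intro C' X A hC' hAS hAN hlight hXle hcX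
    have hAcard : A.card ≤ K := (Finset.card_le_card hAS).trans hcard
    have hXR : (X : ℝ) ≤ (((∏ p ∈ S, p) *
        ∏ p ∈ N.primeFactors \ S, p ^ ((N.factorization p + 3) / 4) : ℕ) : ℝ) *
        (c : ℝ) ^ (θ * K) := by
      have h1 : (X : ℝ) ≤ (((∏ p ∈ S, p) *
          ∏ p ∈ N.primeFactors \ S, p ^ ((N.factorization p + 3) / 4) : ℕ) : ℝ) *
          ((∏ q ∈ A, q ^ N.factorization q : ℕ) : ℝ) := by exact_mod_cast hXle
      refine h1.trans (mul_le_mul_of_nonneg_left ?_ (by positivity))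
      rw [← hcθK]
      exact light_prod_le hc1 hθ.le hAcard hlight
    have hcX' : (c : ℝ) < C₀ * (X : ℝ) ^ (1 + ε₁) :=
      hcX.trans_le (mul_le_mul_of_nonneg_right hC' (by positivity))
    exact real_step hC₀1 hs hds hst hc1R hMS1 (Nat.cast_nonneg X) hXR hcX'
  by_cases hT : T.Nonempty
  · -- CASE A: `S` has heavy primes — the heavy-places stub at `T`
    have key := hheavyK T hT ((Finset.card_le_card hTS).trans hcard) (fun p hp => hS p (hTS hp))
      a b c ⟨ha, hb, hsum, hcop⟩ (fun p hp => (Finset.mem_filter.mp hp).2)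
    refine finish C₂ _ ((N.primeFactors \ T) ∩ S) hC₂le Finset.inter_subset_right
      (fun q hq => (Finset.mem_sdiff.mp (Finset.mem_inter.mp hq).1).1) hlightT ?_ key
    exact (mixed_le_mixed_mul N hTS hS).trans
      (Nat.mul_le_mul_left _ (rounded_le_full N fun q hq =>
        (Finset.mem_sdiff.mp (Finset.mem_inter.mp hq).1).1))
  · -- `T = ∅`: every prime of `S` is light
    have hTempty : T = ∅ := Finset.not_nonempty_iff_eq_empty.mp hT
    have hlightS : ∀ q ∈ (N.primeFactors \ ∅) ∩ S,
        ((q ^ N.factorization q : ℕ) : ℝ) < (c : ℝ) ^ θ := by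
      rw [← hTempty]; exact hlightT
    -- `rad₄(N) ≤ M_S · ∏_{supp N ∩ S} q^{v_q}`
    have hrad4 : ∏ p ∈ N.primeFactors, p ^ ((N.factorization p + 3) / 4) ≤
        ((∏ p ∈ S, p) * ∏ p ∈ N.primeFactors \ S, p ^ ((N.factorization p + 3) / 4)) *
          ∏ q ∈ (N.primeFactors \ ∅) ∩ S, q ^ N.factorization q := by
      have h := mixed_le_mixed_mul N (Finset.empty_subset S) hS
      rw [Finset.prod_empty, one_mul, Finset.sdiff_empty] at h
      rw [Finset.sdiff_empty]
      exact h.trans (Nat.mul_le_mul_left _ (rounded_le_full N fun q hq =>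
        (Finset.mem_inter.mp hq).1))
    by_cases hH : ∃ p ∈ N.primeFactors, (c : ℝ) ^ θ ≤ ((p ^ N.factorization p : ℕ) : ℝ)
    · -- CASE B: some prime of `abc` is heavy (but none in `S`) — the heavy-places stub at `{p}`
      obtain ⟨p, hp, hpH⟩ := hH
      have hpP : p.Prime := Nat.prime_of_mem_primeFactors hp
      have key := hheavy1 {p} (Finset.singleton_nonempty p) (by simp) (by simpa using hpP) a b c
        ⟨ha, hb, hsum, hcop⟩
        (by simpa using hpH)
      refine finish C₃ _ ((N.primeFactors \ ∅) ∩ S) hC₃le Finset.inter_subset_right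
        (fun q hq => by simpa using (Finset.mem_inter.mp hq).1) hlightS ?_ key
      -- `M_{p} ≤ rad₄(N)`
      refine le_trans ?_ hrad4
      have hv : 0 < N.factorization p :=
        hpP.factorization_pos_of_dvd hN0 (Nat.dvd_of_mem_primeFactors hp)
      have he : (N.factorization p + 3) / 4 ≠ 0 := by omega
      rw [Finset.prod_singleton, Finset.sdiff_singleton_eq_erase,
        ← Finset.mul_prod_erase N.primeFactors (fun q => q ^ ((N.factorization q + 3) / 4)) hp]
      exact Nat.mul_le_mul_right _ (Nat.le_self_pow he p)
    · -- CASE C: the triple is flat — the flat-face stub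
      push Not at hH
      have key := hflat a b c ⟨ha, hb, hsum, hcop⟩ hH
      exact finish C₁ _ ((N.primeFactors \ ∅) ∩ S) hC₁le Finset.inter_subset_right
        (fun q hq => by simpa using (Finset.mem_inter.mp hq).1) hlightS hrad4 key

/-! ## Losslessness: both stubs are consequences of the crux (the re-cut loses nothing) -/

/-- The crux implies `stub_flatFace` (its `K = 0`, `S = ∅` instance; the flatness hypothesis and
the cap `θ ≤ 1/4` are simply not used). [folklore] -/
theorem flatFace_of_uniformSadicTowerFour (hU : UniformSadicTowerFour) :
    ∀ θ : ℝ, 0 < θ → θ ≤ 1 / 4 → ∀ ε : ℝ, 0 < ε → ∃ C : ℝ, 0 < C ∧ ∀ a b c : ℕ, IsABCTriple a b c →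
      (∀ p ∈ (a * b * c).primeFactors,
        ((p ^ (a * b * c).factorization p : ℕ) : ℝ) < (c : ℝ) ^ θ) →
      (c : ℝ) < C * ((∏ p ∈ (a * b * c).primeFactors,
        p ^ (((a * b * c).factorization p + 3) / 4) : ℕ) : ℝ) ^ (1 + ε) := by
  intro θ _ _ ε hε
  obtain ⟨C, hC, hK⟩ := (stub_normalForm.mp hU) 0 ε hε
  refine ⟨C, hC, fun a b c habc _ => ?_⟩
  have h := hK ∅ (by simp) (by simp) a b c habc
  simpa [Finset.sdiff_empty] using h

/-- The crux implies `stub_heavyPlaces` (its budget-`K` instance; non-emptiness and heaviness of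
`S` are simply not used). [folklore] -/
theorem heavyPlaces_of_uniformSadicTowerFour (hU : UniformSadicTowerFour) :
    ∀ K : ℕ, ∀ θ : ℝ, 0 < θ → ∀ ε : ℝ, 0 < ε → ∃ C : ℝ, 0 < C ∧ ∀ S : Finset ℕ, S.Nonempty →
      S.card ≤ K → (∀ p ∈ S, Nat.Prime p) → ∀ a b c : ℕ, IsABCTriple a b c →
      (∀ p ∈ S, (c : ℝ) ^ θ ≤ ((p ^ (a * b * c).factorization p : ℕ) : ℝ)) →
      (c : ℝ) < C * ((((∏ p ∈ S, p) *
        ∏ p ∈ (a * b * c).primeFactors \ S, p ^ (((a * b * c).factorization p + 3) / 4) : ℕ) : ℝ)) ^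
          (1 + ε) := by
  intro K θ _ ε hε
  obtain ⟨C, hC, hK⟩ := (stub_normalForm.mp hU) K ε hε
  exact ⟨C, hC, fun S _ hcard hS a b c habc _ => hK S hcard hS a b c habc⟩

/-- **The re-cut is lossless**: the crux `UniformSadicTowerFour` is EQUIVALENT to the conjunction
(flat face) ∧ (heavy places).  Single named handle for a route-level split of stmt-ABC-14937 into
the two regimes (glue = `uniformSadicTowerFour_of_flat_of_heavy`). [folklore] -/
theorem uniformSadicTowerFour_iff_flat_and_heavy :
    UniformSadicTowerFour ↔
      ((∀ θ : ℝ, 0 < θ → θ ≤ 1 / 4 → ∀ ε : ℝ, 0 < ε → ∃ C : ℝ, 0 < C ∧ ∀ a b c : ℕ,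
        IsABCTriple a b c →
        (∀ p ∈ (a * b * c).primeFactors,
          ((p ^ (a * b * c).factorization p : ℕ) : ℝ) < (c : ℝ) ^ θ) →
        (c : ℝ) < C * ((∏ p ∈ (a * b * c).primeFactors,
          p ^ (((a * b * c).factorization p + 3) / 4) : ℕ) : ℝ) ^ (1 + ε)) ∧
      (∀ K : ℕ, ∀ θ : ℝ, 0 < θ → ∀ ε : ℝ, 0 < ε → ∃ C : ℝ, 0 < C ∧ ∀ S : Finset ℕ, S.Nonempty →
        S.card ≤ K → (∀ p ∈ S, Nat.Prime p) → ∀ a b c : ℕ, IsABCTriple a b c →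
        (∀ p ∈ S, (c : ℝ) ^ θ ≤ ((p ^ (a * b * c).factorization p : ℕ) : ℝ)) →
        (c : ℝ) < C * ((((∏ p ∈ S, p) *
          ∏ p ∈ (a * b * c).primeFactors \ S, p ^ (((a * b * c).factorization p + 3) / 4) : ℕ) : ℝ)) ^
            (1 + ε))) :=
  ⟨fun hU => ⟨flatFace_of_uniformSadicTowerFour hU, heavyPlaces_of_uniformSadicTowerFour hU⟩,
    fun h => uniformSadicTowerFour_of_flat_of_heavy h.1 h.2⟩

end Summit.ABC.ABC.Theorems.UniformSadicTowerFour.FlatSteepSplit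

end
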